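import Summits.CriticalPhenomena.Ising3D.TaylorTableTheorem
import Summits.CriticalPhenomena.Ising3D.TaylorRegionBoxInputs
import Mathlib.Tactic.Linarith
import Mathlib.Tactic.Ring
import HarnessLib

/-!
# The two REGION hypotheses of the TABLE theorem from kernel-route certificates; `BoxExcluded` from Booleans
(cell `pub-ising3x`, seat recog-1 gen 11 — glue between recog's region checkers (`TaylorRegionBoxInputs`) and
boot-1 g6's `TaylorTable.boxExcluded_of_taylorTable_of_fields`; gate (g2))

HONEST FRAMING: lottery ticket; floor = tightest certified 3D Ising CFT bounds; no exact-solution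
claim without a proof. Island framing: certified exclusion region at stated derivative order and
assumptions; not a determination of the 3D Ising critical exponents beyond that.

boot-1's table theorem leaves three named hypotheses: `T.Enclosures` (block-coefficient tables), the even
REGION field `TaylorEvenRegion T.α T.box T.E₀` and `T.OddCone`. The last two are discharged here by recog's
turnkey certificates built from THE TABLE'S OWN DATA (`T.c`, `T.L`, `T.ψ`, `T.Lψ`, `T.κ₀`, the box, `T.E₀`,
`T.E_T`) plus region parameters (`EvenRegionParams` / `OddConeParams`: scale, centre `cc`, row count, checker
parameters, and for the odd cone six root atoms): `evenRegion_of_evenCert`, `oddCone_of_oddCert`, and the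
one-shot **`boxExcluded_of_taylorTable_of_certs`**:
`T.check = true → T.Enclosures → (T.evenCert πE).check = true → (T.oddCert πO).check = true → BoxExcluded T.box`.
So, GIVEN the enclosure hypothesis, a kind-`deriv` box certificate is three `decide +kernel` Booleans.
SUFFICIENT only on the region side (kernel route, symmetrised kernel). Elementary glue. [folklore]
-/

namespace Summit.CriticalPhenomena.Ising3D

open Set
open Literature.MathematicalPhysics.QuantumFieldTheory.ConformalBootstrap3D

/-- Region parameters for the even sector (the data is the table's). [folklore] -/
structure EvenRegionParams where
  /-- fixed-point scale -/
  S : ℕ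
  /-- centre of the `P` variable (`P = u + v - cc`; `P₀ = E₀ - cc`) -/
  ccQ : ℚ
  /-- row count of the substituted tables -/
  N : ℕ
  /-- checker parameters -/
  prmX : HSParams
  prmY : HSParams
  prmD : HSParams

/-- Region parameters for the odd cone (the data is the table's; six root atoms for the powers of `½`). [folklore] -/
structure OddConeParams where
  S : ℕ
  ccQ : ℚ
  N : ℕ
  k1lo : RootAtom
  k1hi : RootAtom
  k2lo : RootAtom
  k2hi : RootAtom
  k3lo : RootAtom
  k3hi : RootAtom
  prmM1 : HSParams
  prmM2 : HSParams
  prmR1 : HSParams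
  prmR2 : HSParams

namespace TaylorTable

variable (T : TaylorTable)

/-- The even-region certificate of the table for parameters `π`. [folklore] -/
def evenCert (π : EvenRegionParams) : EvenRegionCert where
  S := π.S
  box := ⟨T.σlo, T.σhi, T.εlo, T.εhi⟩
  l := T.L
  cQ := T.c
  ccQ := π.ccQ
  P0 := T.E₀ - π.ccQ
  N := π.N
  prmX := π.prmX
  prmY := π.prmY
  prmD := π.prmD

/-- The odd-cone certificate of the table for parameters `π`. [folklore] -/
def oddCert (π : OddConeParams) : OddConeRegionCert where
  S := π.S
  box := ⟨T.σlo, T.σhi, T.εlo, T.εhi⟩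
  l := T.L
  cQ := T.c
  lψ := T.Lψ
  ψQ := T.ψ
  κ₀Q := T.κ₀
  k1lo := π.k1lo
  k1hi := π.k1hi
  k2lo := π.k2lo
  k2hi := π.k2hi
  k3lo := π.k3lo
  k3hi := π.k3hi
  ccQ := π.ccQ
  P0 := T.E_T - π.ccQ
  N := π.N
  prmM1 := π.prmM1
  prmM2 := π.prmM2
  prmR1 := π.prmR1
  prmR2 := π.prmR2

/-- **The even REGION field of the table from its even certificate.** [folklore] -/
theorem evenRegion_of_evenCert (π : EvenRegionParams) (h : (T.evenCert π).check = true) :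
    TaylorEvenRegion T.α T.box ((T.E₀ : ℚ) : ℝ) := by
  have hR := taylorEvenRegion_of_cert_rat (T.evenCert π) h
  simp only [evenCert, sub_add_cancel] at hR
  exact hR

/-- **The odd-cone hypothesis of the table from its odd certificate.** [folklore] -/
theorem oddCone_of_oddCert (π : OddConeParams) (h : (T.oddCert π).check = true) : T.OddCone := by
  have hC := oddCone_of_cert_rat (T.oddCert π) h
  simp only [oddCert, sub_add_cancel] at hC
  exact hC

/-- **`BoxExcluded` from the table check, the enclosure hypothesis, and the two region certificates.** [folklore] -/
theorem boxExcluded_of_taylorTable_of_certs (h : T.check = true) (hEnc : T.Enclosures) (πE : EvenRegionParams)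
    (hE : (T.evenCert πE).check = true) (πO : OddConeParams) (hO : (T.oddCert πO).check = true) :
    BoxExcluded T.box :=
  T.boxExcluded_of_taylorTable_of_fields h hEnc (T.evenRegion_of_evenCert πE hE) (T.oddCone_of_oddCert πO hO)

end TaylorTable

end Summit.CriticalPhenomena.Ising3D
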